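import Literature.Probability.RandomPlanarGeometry.SAWKestenBridgesZ2
import Literature.Probability.RandomPlanarGeometry.SAWKestenRatioRateZ2Std
import HarnessLib

/-!
# Kesten's ratio inequality for bridges on `ℤ²`, explicit constant, every `n ≥ 1` — STANDARD axioms

Topic `Literature/Probability/RandomPlanarGeometry` (lane pcv-sawmu items KR-BR × X25 «K-ONLY»; continues
`SAWKestenBridgesZ2.lean` = the generic `Zd.kestenIneqBridgesZ2_of_hairpinSparse` and its instance of record at
`Q = 320` through the certified `μ(ℤ²) ≥ 2.604`, and `SAWKestenRatioRateZ2Std.lean` = the hairpin-sparsity input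
`KestenHairpin.hairpinSparse_Z2_25` at `Q = 1360` from the standard-axiom bound `μ(ℤ²) ≥ 5/2`). Plugging the second
into the first (split parameter `η = 1/4`): **`Zd.kestenIneqBridgesZ2_std : KestenIneqBridgesZ2 (3·10³²)`**, i.e.
`b_{n+2}/b_n − 3·10³²/n ≤ b_{n+4}/b_{n+2}` for every `n ≥ 1`, axioms `[propext, Classical.choice, Quot.sound]`
(Madras–Slade Theorem 7.3.2 (b) prints `∃ D`, `N` large). The constant: `K_Ξ(1360, Σ_{r<40} c_r, 1/4) ≤ 2.45·10³⁰`
(`(12·1360/(¼ log 2))⁶ ≤ 94181⁶`, `Σ_{r<40} c_r ≤ 2·3³⁹`, `1360/(¾ log 2) ≤ 2617`), `B ≤ 2.35·10³²`.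
Also (K1 companion, standard axioms): `Zd.pow_25_le_bridgeCount : (5/2)^n ≤ (5/2)^61 · b_n` for every `n`.

## References

* N. Madras, G. Slade, *The Self-Avoiding Walk* (1993), Theorem 7.3.2 (b), Lemma 7.3.1.
-/

noncomputable section

open Finset Literature.Probability.LatticeModels
open scoped BigOperators

namespace Literature.Probability.RandomPlanarGeometry.SAW.Zd

/-- **Kesten's bridge inequality on `ℤ²`, closed-form constant, standard axioms** (`Q = 1360`, `C = Σ_{r<40} c_r`,
`η = 1/4`). [cite: MadrasSlade1993, Theorem 7.3.2 (b), eq. (7.3.4) with (7.3.3) (explicit, hairpin variant)] -/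
theorem kestenIneqBridgesZ2_std_closedForm :
    KestenIneqBridgesZ2 (KestenHairpin.kestenBW 0 1360
      (bridgeKXi 1360 (∑ r ∈ Finset.range 40, (count 2 r : ℝ)) (1 / 4)) bridgeKZ) :=
  kestenIneqBridgesZ2_of_hairpinSparse (by norm_num) (Finset.sum_nonneg fun _ _ => Nat.cast_nonneg _)
    (by norm_num) (by norm_num) KestenHairpin.hairpinSparse_Z2_25

/-- `Σ_{r<40} c_r ≤ 2·3³⁹` (from `c_{n+1} ≤ 4·3ⁿ`). [cite: MadrasSlade1993, §1.2, eq. (1.2.10) (`c_N ≤ 2d(2d-1)^{N-1}`)] -/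
theorem sum_count_lt_forty_le : ∑ r ∈ Finset.range 40, (count 2 r : ℝ) ≤ 8105110306037952534 := by
  have hr : ∀ r : ℕ, (count 2 r : ℝ) ≤ 4 / 3 * 3 ^ r := by
    intro r
    rcases Nat.eq_zero_or_pos r with rfl | hr
    · rw [count_zero]; norm_num
    · obtain ⟨n, rfl⟩ : ∃ n, r = n + 1 := ⟨r - 1, by omega⟩
      have h := count_succ_le 2 n
      have : (count 2 (n + 1) : ℝ) ≤ 2 * 2 * (2 * 2 - 1 : ℕ) ^ n := by exact_mod_cast h
      norm_num at this
      rw [pow_succ]; linarith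
  calc ∑ r ∈ Finset.range 40, (count 2 r : ℝ) ≤ ∑ r ∈ Finset.range 40, (4 / 3 * 3 ^ r : ℝ) :=
        Finset.sum_le_sum fun r _ => hr r
    _ ≤ 8105110306037952534 := by simp only [Finset.sum_range_succ, Finset.sum_range_zero]; norm_num

/-- `K_Ξ(1360, Σ_{r<40} c_r, 1/4) ≤ 2 441 095 007 696 702 390 776 517 879 185 ≈ 2.44·10³⁰`. [folklore] -/
private theorem bridgeKXi_std_le :
    bridgeKXi 1360 (∑ r ∈ Finset.range 40, (count 2 r : ℝ)) (1 / 4) ≤ 2441095007696702390776517879185 := by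
  have hL := Real.log_two_gt_d9
  have hL0 : 0 < Real.log 2 := by linarith
  have hC := sum_count_lt_forty_le
  have hC0 : 0 ≤ ∑ r ∈ Finset.range 40, (count 2 r : ℝ) := Finset.sum_nonneg (fun _ _ => Nat.cast_nonneg _)
  have h1 : 12 * ((1360 : ℕ) : ℝ) / ((1 / 4) * Real.log 2) ≤ (94181 : ℝ) := by
    rw [div_le_iff₀ (by positivity)]; push_cast; nlinarith
  have h1' : (12 * ((1360 : ℕ) : ℝ) / ((1 / 4) * Real.log 2)) ^ 6 ≤ (94181 : ℝ) ^ 6 :=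
    pow_le_pow_left₀ (by positivity) h1 6
  have h2 : (((1360 : ℕ) : ℝ)) / ((1 - 1 / 4) * Real.log 2) ≤ 2617 := by
    rw [div_le_iff₀ (by norm_num; positivity)]; push_cast; nlinarith
  have h2' : ((((1360 : ℕ) : ℝ)) / ((1 - 1 / 4) * Real.log 2)) ^ 3 ≤ (2617 : ℝ) ^ 3 :=
    pow_le_pow_left₀ (by apply div_nonneg (by norm_num); norm_num; positivity) h2 3
  have h3 : (∑ r ∈ Finset.range 40, (count 2 r : ℝ)) * (12 * ((((1360 : ℕ) : ℝ)) / ((1 - 1 / 4) * Real.log 2)) ^ 3) ≤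
      8105110306037952534 * (12 * (2617 : ℝ) ^ 3) :=
    mul_le_mul hC (by linarith) (by positivity) (by norm_num)
  unfold bridgeKXi
  have : (94181 : ℝ) ^ 6 + 8105110306037952534 * (12 * (2617 : ℝ) ^ 3) = 2441095007696702390776517879185 := by
    norm_num
  linarith

/-- **The constant is at most `3·10³²`.** [folklore] -/
private theorem kestenBW_std_le :
    KestenHairpin.kestenBW 0 1360 (bridgeKXi 1360 (∑ r ∈ Finset.range 40, (count 2 r : ℝ)) (1 / 4)) bridgeKZ ≤
      3 * 10 ^ 32 := by
  have h1 := bridgeKXi_std_le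
  have h2 := bridgeKZ_le
  unfold KestenHairpin.kestenBW
  push_cast
  nlinarith

/-- **Kesten's ratio inequality for bridges on `ℤ²` with `B = 3·10³²`, every `n ≥ 1`, STANDARD axioms**:
`b_{n+2}/b_n − 3·10³²/n ≤ b_{n+4}/b_{n+2}`.
[cite: MadrasSlade1993, Theorem 7.3.2 (b), eq. (7.3.4) with (7.3.3) (explicit constant, all `n ≥ 1`; hairpin variant)] -/
theorem kestenIneqBridgesZ2_std : KestenIneqBridgesZ2 (3 * 10 ^ 32) :=
  kestenIneqBridgesZ2_std_closedForm.mono kestenBW_std_le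


/-! ### K1 companion: an explicit exponential lower bound for bridges with standard axioms -/

/-- Words of the span-1 family have length `≤ 61`. [folklore] -/
private theorem length_le_of_mem_spanOneFamily : ∀ s ∈ spanOneFamily, s.length ≤ 61 := by
  intro s hs
  rw [spanOneFamily, Finset.mem_union, Finset.mem_image, Finset.mem_image] at hs
  rcases hs with ⟨k, hk, rfl⟩ | ⟨k, hk, rfl⟩
  · rw [length_vertWord]; rw [Finset.mem_range] at hk; omega
  · rw [length_vertWord]; rw [Finset.mem_range] at hk; omega

set_option maxRecDepth 100000 in
/-- Words of the span-2 family have length `≤ 61` (indeed `≤ 11`). [folklore] -/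
private theorem length_le_of_mem_spanTwoFamily : ∀ s ∈ spanTwoFamily, s.length ≤ 61 := by
  intro s hs
  simp only [spanTwoFamily, Finset.mem_union, List.mem_toFinset] at hs
  rcases hs with ((((h | h) | h) | h) | h) | h
  · exact (by decide : ∀ s ∈ spanTwo6, s.length ≤ 61) s h
  · exact (by decide : ∀ s ∈ spanTwo7, s.length ≤ 61) s h
  · exact (by decide : ∀ s ∈ spanTwo8, s.length ≤ 61) s h
  · exact (by decide : ∀ s ∈ spanTwo9, s.length ≤ 61) s h
  · exact (by decide : ∀ s ∈ spanTwo10, s.length ≤ 61) s h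
  · exact (by decide : ∀ s ∈ spanTwo11, s.length ≤ 61) s h

/-- **`(5/2)^n ≤ (5/2)^61 · b_n` on `ℤ²` for every `n`, STANDARD axioms** (the K1 Kraft family
`spanOneFamily ∪ spanTwoFamily`, Kraft sum `1.0022 ≥ 1` at `2/5`, maximal block length `61`, through the explicit
renewal bound `Renewal.pow_le_pow_mul_dseq`): an all-`n` companion of `le_connectiveConstant_25`.
[cite: Jensen2004SAWLowerBounds, §2, eq. (3)–(4)] -/
theorem pow_25_le_bridgeCount (n : ℕ) : (5 / 2 : ℝ) ^ n ≤ (5 / 2 : ℝ) ^ 61 * bridgeCount 2 n := by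
  have hadm : Renewal.Admissible (spanOneFamily ∪ spanTwoFamily) := by
    intro s hs
    rcases Finset.mem_union.1 hs with h | h
    · exact (spanOneFamily_spec s h).1
    · exact (spanTwoFamily_spec s h).1
  have h0 : [(0 : Step)] ∈ spanOneFamily ∪ spanTwoFamily := Finset.mem_union.2 (Or.inl nil_cons_mem_spanOneFamily)
  have hx1 : ∀ s ∈ spanOneFamily, xEnd s < 2 := fun s hs => by rw [(spanOneFamily_spec s hs).2]; norm_num
  have hK : (1 : ℝ) ≤ ∑ s ∈ spanOneFamily ∪ spanTwoFamily, (5 / 2 : ℝ)⁻¹ ^ s.length := by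
    rw [sum_union_of_xEnd hx1 (fun s hs => (spanTwoFamily_spec s hs).2), show (5 / 2 : ℝ)⁻¹ = 2 / 5 by norm_num,
      kraft_spanOneFamily_at, kraft_spanTwoFamily]
    exact kraft_numeric_25
  have hM : ∀ s ∈ spanOneFamily ∪ spanTwoFamily, s.length ≤ 61 := by
    intro s hs
    rcases Finset.mem_union.1 hs with h | h
    · exact length_le_of_mem_spanOneFamily s h
    · exact length_le_of_mem_spanTwoFamily s h
  have h1 := Renewal.pow_le_pow_mul_dseq hadm h0 (by norm_num : (1 : ℝ) ≤ 5 / 2) hK hM n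
  have h2 : (Renewal.dseq (spanOneFamily ∪ spanTwoFamily) n : ℝ) ≤ bridgeCount 2 n := by
    exact_mod_cast Renewal.dseq_le_bridgeCount hadm n
  exact h1.trans (mul_le_mul_of_nonneg_left h2 (by positivity))

end Literature.Probability.RandomPlanarGeometry.SAW.Zd
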